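import Mathlib
import HarnessLib

/-!
# Rational points on a diagonal conic: the parametrising quadratic map (algebra)

Browning–Van Valckenborgh 2012 (*Sums of three squareful numbers*, Exp. Math. **21**, §3) count
the rational points of bounded height on the conics `C_y : y₀³x₀² + y₁³x₁² = y₂³x₂²` through
the Franke–Manin–Tschinkel asymptotic. The tree proves that asymptotic by the classical route:
project the conic from one rational point `P`. This file is the coordinate algebra of that
projection, for a diagonal ternary form `F(u) = A₀u₀² + A₁u₁² + A₂u₂²` over `ℤ` with bilinear
form `⟨u, v⟩ = Σ Aᵢuᵢvᵢ` and a zero `P` of `F`: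

* `ternForm A u`, `ternBilin A u v` — `F` and `⟨·,·⟩`;
* `conicMap A P u = F(u) P − 2⟨u, P⟩ u` — the second intersection of the line through `P` with
  direction `u` (`ternForm_conicMap`: it is a zero of `F`; `conicMap_add_zsmul`: it only depends
  on `u` modulo `P`; `conicMap_zsmul`: it is quadratic in `u`; `conicMap_self`: a zero `x` of
  `F` is sent to `−2⟨x, P⟩ x`);
* `minors_eq_zero_of_isotropic` — two zeros `x, P` of `F` with `⟨x, P⟩ = 0` are proportional
  (all `Aᵢ ≠ 0`): a nondegenerate ternary form has no totally isotropic plane (proved through the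
  Lagrange identities `(A₀x₀² + A₁x₁²)(A₀P₀² + A₁P₁²) − (A₀x₀P₀ + A₁x₁P₁)² = A₀A₁(x₀P₁ − x₁P₀)²`);
* `idet3` — the `3 × 3` integer determinant, the Cramer expansion `idet3_cramer` and
  `exists_unimodular_completion`: a primitive `P ∈ ℤ³` is the first row of a matrix of
  `SL₃(ℤ)` (so `ℤ³ = ℤP ⊕ ℤe₁ ⊕ ℤe₂`);
* `content3 x = gcd(x₀, x₁, x₂)` and its behaviour under scaling.

Everything is elementary and proved; the definitions are plain polynomial maps on `ℤ × ℤ × ℤ`.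

## References

* T. D. Browning, K. Van Valckenborgh, *Sums of three squareful numbers*, Exp. Math. 21 (2012)
  204–211, §3. [cite: BrowningValckenborgh2012, §3]
-/

namespace Literature.NumberTheory.DiophantineGeometry

/-! ### The form, its bilinear form, the parametrising map -/

/-- The diagonal ternary quadratic form `F(u) = A₀u₀² + A₁u₁² + A₂u₂²` with integer
coefficients `A = (A₀, A₁, A₂)`. [folklore] -/
def ternForm (A u : ℤ × ℤ × ℤ) : ℤ :=
  A.1 * u.1 ^ 2 + A.2.1 * u.2.1 ^ 2 + A.2.2 * u.2.2 ^ 2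

/-- The symmetric bilinear form `⟨u, v⟩ = A₀u₀v₀ + A₁u₁v₁ + A₂u₂v₂` of `ternForm A`
(so `F(u) = ⟨u, u⟩`). [folklore] -/
def ternBilin (A u v : ℤ × ℤ × ℤ) : ℤ :=
  A.1 * u.1 * v.1 + A.2.1 * u.2.1 * v.2.1 + A.2.2 * u.2.2 * v.2.2

/-- **The parametrising quadratic map** of the conic `F = 0` from the point `P`:
`u ↦ F(u) P − 2⟨u, P⟩ u`, the second intersection point of the conic with the line through `P`
in the direction `u` (up to scaling). [folklore] -/
def conicMap (A P u : ℤ × ℤ × ℤ) : ℤ × ℤ × ℤ :=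
  (ternForm A u * P.1 - 2 * ternBilin A u P * u.1,
    ternForm A u * P.2.1 - 2 * ternBilin A u P * u.2.1,
    ternForm A u * P.2.2 - 2 * ternBilin A u P * u.2.2)

/-- Unfolding `ternForm`. [folklore] -/
theorem ternForm_apply (A u : ℤ × ℤ × ℤ) :
    ternForm A u = A.1 * u.1 ^ 2 + A.2.1 * u.2.1 ^ 2 + A.2.2 * u.2.2 ^ 2 := rfl

/-- Unfolding `ternBilin`. [folklore] -/
theorem ternBilin_apply (A u v : ℤ × ℤ × ℤ) :
    ternBilin A u v = A.1 * u.1 * v.1 + A.2.1 * u.2.1 * v.2.1 + A.2.2 * u.2.2 * v.2.2 := rfl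

/-- `⟨u, u⟩ = F(u)`. [folklore] -/
theorem ternBilin_self (A u : ℤ × ℤ × ℤ) : ternBilin A u u = ternForm A u := by
  simp only [ternBilin, ternForm]; ring

/-- `⟨u, v⟩ = ⟨v, u⟩`. [folklore] -/
theorem ternBilin_comm (A u v : ℤ × ℤ × ℤ) : ternBilin A u v = ternBilin A v u := by
  simp only [ternBilin]; ring

/-- Polarisation: `F(u + v) = F(u) + 2⟨u, v⟩ + F(v)`. [folklore] -/
theorem ternForm_add (A u v : ℤ × ℤ × ℤ) :
    ternForm A (u + v) = ternForm A u + 2 * ternBilin A u v + ternForm A v := by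
  simp only [ternForm, ternBilin, Prod.fst_add, Prod.snd_add]; ring

/-- `F(k u) = k² F(u)`. [folklore] -/
theorem ternForm_zsmul (A : ℤ × ℤ × ℤ) (k : ℤ) (u : ℤ × ℤ × ℤ) :
    ternForm A (k • u) = k ^ 2 * ternForm A u := by
  simp only [ternForm, Prod.smul_fst, Prod.smul_snd, smul_eq_mul]; ring

/-- `⟨k u, v⟩ = k ⟨u, v⟩`. [folklore] -/
theorem ternBilin_zsmul_left (A : ℤ × ℤ × ℤ) (k : ℤ) (u v : ℤ × ℤ × ℤ) :
    ternBilin A (k • u) v = k * ternBilin A u v := by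
  simp only [ternBilin, Prod.smul_fst, Prod.smul_snd, smul_eq_mul]; ring

/-- `⟨u + w, v⟩ = ⟨u, v⟩ + ⟨w, v⟩`. [folklore] -/
theorem ternBilin_add_left (A u w v : ℤ × ℤ × ℤ) :
    ternBilin A (u + w) v = ternBilin A u v + ternBilin A w v := by
  simp only [ternBilin, Prod.fst_add, Prod.snd_add]; ring

/-- The components of `conicMap`. [folklore] -/
theorem conicMap_fst (A P u : ℤ × ℤ × ℤ) :
    (conicMap A P u).1 = ternForm A u * P.1 - 2 * ternBilin A u P * u.1 := rfl

/-- The components of `conicMap`. [folklore] -/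
theorem conicMap_snd_fst (A P u : ℤ × ℤ × ℤ) :
    (conicMap A P u).2.1 = ternForm A u * P.2.1 - 2 * ternBilin A u P * u.2.1 := rfl

/-- The components of `conicMap`. [folklore] -/
theorem conicMap_snd_snd (A P u : ℤ × ℤ × ℤ) :
    (conicMap A P u).2.2 = ternForm A u * P.2.2 - 2 * ternBilin A u P * u.2.2 := rfl

/-- `conicMap A P u = F(u) • P − (2⟨u,P⟩) • u` as vectors. [folklore] -/
theorem conicMap_eq_smul_sub_smul (A P u : ℤ × ℤ × ℤ) :
    conicMap A P u = ternForm A u • P - (2 * ternBilin A u P) • u := by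
  ext <;> simp [conicMap]

/-- **The image of the parametrising map lies on the conic**: if `F(P) = 0` then
`F(conicMap A P u) = 0`. [folklore] -/
theorem ternForm_conicMap {A P : ℤ × ℤ × ℤ} (hP : ternForm A P = 0) (u : ℤ × ℤ × ℤ) :
    ternForm A (conicMap A P u) = 0 := by
  simp only [ternForm, ternBilin, conicMap] at hP ⊢
  linear_combination
    (A.1 * u.1 ^ 2 + A.2.1 * u.2.1 ^ 2 + A.2.2 * u.2.2 ^ 2) ^ 2 * hP

/-- **`conicMap` only depends on `u` modulo `P`**: `conicMap A P (u + k P) = conicMap A P u`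
when `F(P) = 0`. [folklore] -/
theorem conicMap_add_zsmul {A P : ℤ × ℤ × ℤ} (hP : ternForm A P = 0) (u : ℤ × ℤ × ℤ) (k : ℤ) :
    conicMap A P (u + k • P) = conicMap A P u := by
  simp only [ternForm] at hP
  ext <;> simp only [conicMap, ternForm, ternBilin, Prod.fst_add, Prod.snd_add, Prod.smul_fst,
    Prod.smul_snd, smul_eq_mul]
  · linear_combination (-(k ^ 2 * P.1) - 2 * k * u.1) * hP
  · linear_combination (-(k ^ 2 * P.2.1) - 2 * k * u.2.1) * hP
  · linear_combination (-(k ^ 2 * P.2.2) - 2 * k * u.2.2) * hP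

/-- `conicMap` is homogeneous quadratic: `conicMap A P (k u) = k² conicMap A P u`. [folklore] -/
theorem conicMap_zsmul (A P : ℤ × ℤ × ℤ) (k : ℤ) (u : ℤ × ℤ × ℤ) :
    conicMap A P (k • u) = (k ^ 2) • conicMap A P u := by
  ext <;> simp only [conicMap, ternForm, ternBilin, Prod.smul_fst, Prod.smul_snd, smul_eq_mul] <;>
    ring

/-- `conicMap A P (-u) = conicMap A P u`. [folklore] -/
theorem conicMap_neg (A P u : ℤ × ℤ × ℤ) : conicMap A P (-u) = conicMap A P u := by
  have h := conicMap_zsmul A P (-1) u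
  simp only [neg_smul, one_smul] at h
  simpa using h

/-- **A zero of `F` is sent to a multiple of itself**: `conicMap A P x = (−2⟨x, P⟩) • x` when
`F(x) = 0` (the line `Px` meets the conic again at `x`). [folklore] -/
theorem conicMap_self {A x : ℤ × ℤ × ℤ} (P : ℤ × ℤ × ℤ) (hx : ternForm A x = 0) :
    conicMap A P x = (-2 * ternBilin A x P) • x := by
  ext <;> simp only [conicMap, hx, zero_mul, zero_sub, Prod.smul_fst, Prod.smul_snd,
    smul_eq_mul] <;> ring

/-- The direction `P` itself gives `0`: `conicMap A P P = 0` when `F(P) = 0`. [folklore] -/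
theorem conicMap_base {A P : ℤ × ℤ × ℤ} (hP : ternForm A P = 0) : conicMap A P P = 0 := by
  rw [conicMap_self P hP, ternBilin_self, hP]
  simp

/-! ### No totally isotropic plane: the Lagrange identities -/

/-- **Two orthogonal zeros of a nondegenerate diagonal ternary form are proportional.** If
`A₀A₁A₂ ≠ 0`, `F(x) = F(P) = 0` and `⟨x, P⟩ = 0`, then all `2 × 2` minors of `(x, P)` vanish.
Proof: `A₀A₁(x₀P₁ − x₁P₀)² = (A₀x₀² + A₁x₁²)(A₀P₀² + A₁P₁²) − (A₀x₀P₀ + A₁x₁P₁)²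
= (A₂x₂²)(A₂P₂²) − (A₂x₂P₂)² = 0`, and cyclically. [folklore] -/
theorem minors_eq_zero_of_isotropic {A x P : ℤ × ℤ × ℤ} (hA0 : A.1 ≠ 0) (hA1 : A.2.1 ≠ 0)
    (hA2 : A.2.2 ≠ 0) (hx : ternForm A x = 0) (hP : ternForm A P = 0)
    (hb : ternBilin A x P = 0) :
    x.1 * P.2.1 = x.2.1 * P.1 ∧ x.1 * P.2.2 = x.2.2 * P.1 ∧ x.2.1 * P.2.2 = x.2.2 * P.2.1 := by
  simp only [ternForm, ternBilin] at hx hP hb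
  have h01 : A.1 * A.2.1 * (x.1 * P.2.1 - x.2.1 * P.1) ^ 2 = 0 := by
    linear_combination (A.1 * P.1 ^ 2 + A.2.1 * P.2.1 ^ 2) * hx - A.2.2 * x.2.2 ^ 2 * hP -
      (A.1 * x.1 * P.1 + A.2.1 * x.2.1 * P.2.1 - A.2.2 * x.2.2 * P.2.2) * hb
  have h02 : A.1 * A.2.2 * (x.1 * P.2.2 - x.2.2 * P.1) ^ 2 = 0 := by
    linear_combination (A.1 * P.1 ^ 2 + A.2.2 * P.2.2 ^ 2) * hx - A.2.1 * x.2.1 ^ 2 * hP -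
      (A.1 * x.1 * P.1 + A.2.2 * x.2.2 * P.2.2 - A.2.1 * x.2.1 * P.2.1) * hb
  have h12 : A.2.1 * A.2.2 * (x.2.1 * P.2.2 - x.2.2 * P.2.1) ^ 2 = 0 := by
    linear_combination (A.2.1 * P.2.1 ^ 2 + A.2.2 * P.2.2 ^ 2) * hx - A.1 * x.1 ^ 2 * hP -
      (A.2.1 * x.2.1 * P.2.1 + A.2.2 * x.2.2 * P.2.2 - A.1 * x.1 * P.1) * hb
  refine ⟨?_, ?_, ?_⟩
  · have := (mul_eq_zero.1 h01).resolve_left (mul_ne_zero hA0 hA1)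
    exact sub_eq_zero.1 (pow_eq_zero_iff two_ne_zero |>.1 this)
  · have := (mul_eq_zero.1 h02).resolve_left (mul_ne_zero hA0 hA2)
    exact sub_eq_zero.1 (pow_eq_zero_iff two_ne_zero |>.1 this)
  · have := (mul_eq_zero.1 h12).resolve_left (mul_ne_zero hA1 hA2)
    exact sub_eq_zero.1 (pow_eq_zero_iff two_ne_zero |>.1 this)

/-! ### Content and primitivity -/

/-- The content `gcd(x₀, x₁, x₂) ∈ ℕ` of an integer vector. [folklore] -/
def content3 (x : ℤ × ℤ × ℤ) : ℕ := Int.gcd x.1 (Int.gcd x.2.1 x.2.2)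

/-- Unfolding `content3`. [folklore] -/
theorem content3_apply (x : ℤ × ℤ × ℤ) : content3 x = Int.gcd x.1 (Int.gcd x.2.1 x.2.2) := rfl

/-- The content divides each coordinate. [folklore] -/
theorem content3_dvd (x : ℤ × ℤ × ℤ) :
    (content3 x : ℤ) ∣ x.1 ∧ (content3 x : ℤ) ∣ x.2.1 ∧ (content3 x : ℤ) ∣ x.2.2 := by
  refine ⟨Int.gcd_dvd_left _ _, ?_, ?_⟩
  · exact (Int.gcd_dvd_right x.1 _).trans (Int.gcd_dvd_left _ _)
  · exact (Int.gcd_dvd_right x.1 _).trans (Int.gcd_dvd_right _ _)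

/-- A common divisor of the coordinates divides the content. [folklore] -/
theorem dvd_content3 {x : ℤ × ℤ × ℤ} {k : ℕ} (h1 : (k : ℤ) ∣ x.1) (h2 : (k : ℤ) ∣ x.2.1)
    (h3 : (k : ℤ) ∣ x.2.2) : k ∣ content3 x :=
  Int.dvd_gcd h1 (Int.natCast_dvd_natCast.2 (Int.dvd_gcd h2 h3))

/-- `content3 x = 0 ↔ x = 0`. [folklore] -/
theorem content3_eq_zero_iff (x : ℤ × ℤ × ℤ) : content3 x = 0 ↔ x = 0 := by
  rw [content3, Int.gcd_eq_zero_iff, Int.natCast_eq_zero, Int.gcd_eq_zero_iff]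
  constructor
  · rintro ⟨h1, h2, h3⟩; ext <;> assumption
  · rintro rfl; simp

/-- `content3 (k x) = |k| content3 x`. [folklore] -/
theorem content3_zsmul (k : ℤ) (x : ℤ × ℤ × ℤ) : content3 (k • x) = k.natAbs * content3 x := by
  simp only [content3, Prod.smul_fst, Prod.smul_snd, smul_eq_mul, Int.gcd_eq_natAbs, Int.natAbs_mul,
    Int.natAbs_natCast, Nat.gcd_mul_left]

/-- `content3 (-x) = content3 x`. [folklore] -/
theorem content3_neg (x : ℤ × ℤ × ℤ) : content3 (-x) = content3 x := by
  have := content3_zsmul (-1) x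
  simpa using this

/-- **Proportional primitive vectors are equal up to sign**: if all `2 × 2` minors of `(x, P)`
vanish, `P ≠ 0` and both have content `1`, then `x = P` or `x = −P`. [folklore] -/
theorem eq_or_eq_neg_of_minors_eq_zero {x P : ℤ × ℤ × ℤ}
    (hm : x.1 * P.2.1 = x.2.1 * P.1 ∧ x.1 * P.2.2 = x.2.2 * P.1 ∧ x.2.1 * P.2.2 = x.2.2 * P.2.1)
    (hx : content3 x = 1) (hP : content3 P = 1) : x = P ∨ x = -P := by
  obtain ⟨h01, h02, h12⟩ := hm
  -- a non-zero coordinate `Pᵢ` of `P`, and `Pᵢ • x = xᵢ • P`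
  have key : ∀ (c d : ℤ), c ≠ 0 → c • x = d • P → x = P ∨ x = -P := by
    intro c d hc h
    have h1 : c.natAbs * content3 x = d.natAbs * content3 P := by
      rw [← content3_zsmul, ← content3_zsmul, h]
    rw [hx, hP, mul_one, mul_one] at h1
    rcases Int.natAbs_eq_natAbs_iff.1 h1 with hcd | hcd
    · left
      rw [← hcd] at h
      exact smul_right_injective _ hc h
    · right
      rw [← neg_eq_iff_eq_neg] at hcd
      rw [← hcd, neg_smul, ← smul_neg] at h
      exact smul_right_injective _ hc h
  by_cases h0 : P.1 ≠ 0
  · exact key P.1 x.1 h0 (by ext <;> simp <;> linarith [h01, h02])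
  by_cases h1 : P.2.1 ≠ 0
  · exact key P.2.1 x.2.1 h1 (by ext <;> simp <;> nlinarith [h01, h12])
  by_cases h2 : P.2.2 ≠ 0
  · exact key P.2.2 x.2.2 h2 (by ext <;> simp <;> nlinarith [h02, h12])
  exfalso
  push Not at h0 h1 h2
  have : content3 P = 0 := (content3_eq_zero_iff P).2 (by ext <;> assumption)
  omega

/-! ### The integer `3 × 3` determinant and unimodular completion -/

/-- The determinant of the integer matrix with rows `u, v, w`. [folklore] -/
def idet3 (u v w : ℤ × ℤ × ℤ) : ℤ :=
  u.1 * (v.2.1 * w.2.2 - v.2.2 * w.2.1) - u.2.1 * (v.1 * w.2.2 - v.2.2 * w.1) +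
    u.2.2 * (v.1 * w.2.1 - v.2.1 * w.1)

/-- Unfolding `idet3`. [folklore] -/
theorem idet3_apply (u v w : ℤ × ℤ × ℤ) : idet3 u v w =
    u.1 * (v.2.1 * w.2.2 - v.2.2 * w.2.1) - u.2.1 * (v.1 * w.2.2 - v.2.2 * w.1) +
      u.2.2 * (v.1 * w.2.1 - v.2.1 * w.1) := rfl

/-- **Cramer expansion**: `det(P,e₁,e₂) • x = det(x,e₁,e₂) • P + det(P,x,e₂) • e₁ + det(P,e₁,x) • e₂`.
[folklore] -/
theorem idet3_cramer (P e₁ e₂ x : ℤ × ℤ × ℤ) :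
    idet3 P e₁ e₂ • x = idet3 x e₁ e₂ • P + idet3 P x e₂ • e₁ + idet3 P e₁ x • e₂ := by
  ext <;> simp only [idet3, Prod.smul_fst, Prod.smul_snd, Prod.fst_add, Prod.snd_add,
    smul_eq_mul] <;> ring

/-- The determinant is linear and alternating in its first row: `det(kP + se₁ + te₂, e₁, e₂) = k det(P, e₁, e₂)`.
[folklore] -/
theorem idet3_comb_fst (P e₁ e₂ : ℤ × ℤ × ℤ) (k s t : ℤ) :
    idet3 (k • P + s • e₁ + t • e₂) e₁ e₂ = k * idet3 P e₁ e₂ := by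
  simp only [idet3, Prod.smul_fst, Prod.smul_snd, Prod.fst_add, Prod.snd_add, smul_eq_mul]; ring

/-- `det(P, kP + se₁ + te₂, e₂) = s det(P, e₁, e₂)`. [folklore] -/
theorem idet3_comb_snd (P e₁ e₂ : ℤ × ℤ × ℤ) (k s t : ℤ) :
    idet3 P (k • P + s • e₁ + t • e₂) e₂ = s * idet3 P e₁ e₂ := by
  simp only [idet3, Prod.smul_fst, Prod.smul_snd, Prod.fst_add, Prod.snd_add, smul_eq_mul]; ring

/-- `det(P, e₁, kP + se₁ + te₂) = t det(P, e₁, e₂)`. [folklore] -/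
theorem idet3_comb_thd (P e₁ e₂ : ℤ × ℤ × ℤ) (k s t : ℤ) :
    idet3 P e₁ (k • P + s • e₁ + t • e₂) = t * idet3 P e₁ e₂ := by
  simp only [idet3, Prod.smul_fst, Prod.smul_snd, Prod.fst_add, Prod.snd_add, smul_eq_mul]; ring

/-- **Unique coordinates for a unimodular triple**: if `det(P, e₁, e₂) = 1` then every `x ∈ ℤ³`
is `k P + s e₁ + t e₂` for unique integers, namely `k = det(x,e₁,e₂)`, `s = det(P,x,e₂)`,
`t = det(P,e₁,x)`. [folklore] -/
theorem eq_comb_of_idet3_eq_one {P e₁ e₂ : ℤ × ℤ × ℤ} (h : idet3 P e₁ e₂ = 1) (x : ℤ × ℤ × ℤ) :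
    x = idet3 x e₁ e₂ • P + idet3 P x e₂ • e₁ + idet3 P e₁ x • e₂ := by
  have := idet3_cramer P e₁ e₂ x
  rwa [h, one_smul] at this

/-- Uniqueness of the coordinates. [folklore] -/
theorem comb_eq_comb_iff {P e₁ e₂ : ℤ × ℤ × ℤ} (h : idet3 P e₁ e₂ = 1) (k s t k' s' t' : ℤ) :
    k • P + s • e₁ + t • e₂ = k' • P + s' • e₁ + t' • e₂ ↔ k = k' ∧ s = s' ∧ t = t' := by
  constructor
  · intro he
    refine ⟨?_, ?_, ?_⟩
    · have := congr_arg (fun v => idet3 v e₁ e₂) he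
      simp only [idet3_comb_fst, h, mul_one] at this
      exact this
    · have := congr_arg (fun v => idet3 P v e₂) he
      simp only [idet3_comb_snd, h, mul_one] at this
      exact this
    · have := congr_arg (fun v => idet3 P e₁ v) he
      simp only [idet3_comb_thd, h, mul_one] at this
      exact this
  · rintro ⟨rfl, rfl, rfl⟩; rfl

/-- **Unimodular completion of a primitive vector**: if `gcd(P₀, P₁, P₂) = 1` there are
`e₁, e₂ ∈ ℤ³` with `det(P, e₁, e₂) = 1`. (With `g = gcd(P₀, P₁) = λP₀ + μP₁` and
`ρg + σP₂ = 1`: `e₁ = (−μ, λ, 0)`, `e₂ = (−σP₀/g, −σP₁/g, ρ)`.) [folklore] -/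
theorem exists_unimodular_completion {P : ℤ × ℤ × ℤ} (hP : content3 P = 1) :
    ∃ e₁ e₂ : ℤ × ℤ × ℤ, idet3 P e₁ e₂ = 1 := by
  set g : ℕ := Int.gcd P.1 P.2.1 with hg
  have hgP : Int.gcd (g : ℤ) P.2.2 = 1 := by
    have : Int.gcd P.1 (Int.gcd P.2.1 P.2.2) = 1 := hP
    rw [← Int.gcd_assoc] at this
    simpa [hg] using this
  -- Bezout for `(g, P₂)` and for `(P₀, P₁)`
  obtain ⟨ρ, σ, hρσ⟩ : ∃ ρ σ : ℤ, ρ * g + σ * P.2.2 = 1 := by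
    refine ⟨Int.gcdA g P.2.2, Int.gcdB g P.2.2, ?_⟩
    have := Int.gcd_eq_gcd_ab (g : ℤ) P.2.2
    rw [hgP] at this
    push_cast at this
    linarith
  have hlm : P.1 * Int.gcdA P.1 P.2.1 + P.2.1 * Int.gcdB P.1 P.2.1 = g := by
    rw [hg]; exact (Int.gcd_eq_gcd_ab P.1 P.2.1).symm
  set lam := Int.gcdA P.1 P.2.1
  set mu := Int.gcdB P.1 P.2.1
  have hd0 : (g : ℤ) ∣ P.1 := Int.gcd_dvd_left _ _
  have hd1 : (g : ℤ) ∣ P.2.1 := Int.gcd_dvd_right _ _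
  obtain ⟨a', ha'⟩ := hd0
  obtain ⟨b', hb'⟩ := hd1
  rcases Nat.eq_zero_or_pos g with hg0 | hgpos
  · -- `P₀ = P₁ = 0`, so `P₂ = ±1`: complete with `(1,0,0)`, `(0,P₂,0)`
    have h1 : P.1 = 0 := by rw [ha', hg0]; simp
    have h2 : P.2.1 = 0 := by rw [hb', hg0]; simp
    rw [hg0] at hρσ
    simp only [CharP.cast_eq_zero, mul_zero, zero_add] at hρσ
    have hsq : P.2.2 ^ 2 = 1 := by
      rcases Int.eq_one_or_neg_one_of_mul_eq_one' hρσ with ⟨-, h⟩ | ⟨-, h⟩ <;> rw [h] <;> norm_num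
    refine ⟨(1, 0, 0), (0, P.2.2, 0), ?_⟩
    simp only [idet3, h1, h2]
    linear_combination hsq
  · have hlm' : lam * a' + mu * b' = 1 := by
      have : (g : ℤ) * (lam * a' + mu * b') = g * 1 :=
        calc (g : ℤ) * (lam * a' + mu * b') = P.1 * lam + P.2.1 * mu := by rw [ha', hb']; ring
          _ = g * 1 := by rw [hlm, mul_one]
      exact mul_left_cancel₀ (by exact_mod_cast hgpos.ne') this
    refine ⟨(-mu, lam, 0), (-(σ * a'), -(σ * b'), ρ), ?_⟩
    simp only [idet3]
    rw [ha', hb']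
    linear_combination (lam * a' + mu * b') * hρσ + hlm'

end Literature.NumberTheory.DiophantineGeometry
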